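import Literature.Analysis.FluidPDE.SeisLogDistanceSlice
import Literature.Analysis.FluidPDE.PassiveScalarEnergySobolev
import Literature.Analysis.Calculus.AbsolutelyContinuousDini
import HarnessLib

/-!
# The evolution of the logarithmic Kantorovich distance at a fixed mollification level

Analysis/FluidPDE proof-support file (everything proved). For a weak solution `θ` of the passive
scalar equation with `L² ∩ Ḣ¹` drift (`‖u(t)‖²_{L²} ≤ M`, `‖∇u(t)‖²_{L²} ≤ G` a.e.), mean-zero
`θ₀ ∈ L²`, `δ > 0` and a kernel `k_ε`, let `Ã(t)` be the everywhere-in-time representative of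
`θ(t) ⋆ k_ε` (`PassiveScalarWeightedFlux.molRep`) and `F(t) = krLogDist δ (Ã(t))`. We prove
(Seis 2022, Lemma 3 integrated in time, at level `ε`, one-sided):

  `F(0) ≤ F(t) + (C_d √G + δ⁻¹ √d ε √G) ∫₀ᵗ ‖θ(s)‖_{L²} ds + κ δ⁻¹ ∫₀ᵗ ‖∇θ(s)‖_{L²} ds`

(`Torus.IsWeakScalarTransportOn.krLogDist_molRep_level`). Proof: `F` is absolutely continuous
(uniformly in the potentials, `abs_integral_mul_molRep_sub_le`); at a.e. `t₀` take an optimal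
pair `(π, ζ)` for `D_δ(Ã(t₀))` (`KantorovichLogDistanceDuality`); then
`F(t₀+h) - F(t₀) ≥ ∫_{t₀}^{t₀+h} ∫ ζ G` and the slice lower bound (`SeisLogDistanceSlice`) with
the frozen profile `Ã(t₀)` and `sup|Ã(s) - Ã(t₀)| ≤ ∫_{t₀}^{s} bound → 0` shows that
`F + K` has nonnegative lower right Dini derivatives at every right Lebesgue point `t₀` of
`s ↦ ‖θ(s)‖_{L²}`, where `K(t) = (C_d √G + δ⁻¹√dε√G) ∫₀ᵗ ‖θ‖₂ + κδ⁻¹ ∫₀ᵗ ‖∇θ‖₂`; absolutely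
continuous functions with a.e. nonnegative lower right Dini derivatives are nondecreasing
(`Calculus/AbsolutelyContinuousDini`). The envelope argument replaces the differentiation of
`t ↦ D_δ(θ(t))` in the printed proof.

## References

* C. Seis, Comm. Math. Phys. 2022 (arXiv:2003.08794), Lemma 3, pp. 7–8. [`Seis2022`]
-/

noncomputable section

open MeasureTheory TopologicalSpace Set Function Filter Topology Metric UnitAddTorus intervalIntegral
open scoped ENNReal NNReal Convolution ContDiff InnerProductSpace

namespace Literature.Analysis.FluidPDE

namespace Torus

open Literature.MeasureTheory.OptimalTransport FunctionSpaces.Torus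

variable {d : Type*} [Fintype d] [DecidableEq d]

namespace IsWeakScalarTransportOn

variable {T κ : ℝ} {u : ℝ → UnitAddTorus d → EuclideanSpace ℝ d} {θ₀ : UnitAddTorus d → ℝ}
  {θ : ℝ → UnitAddTorus d → ℝ}

/-! ## The flux has zero mean; the representative is mean-zero and continuous -/

omit [DecidableEq d] in
/-- `∫ G(s, x) dx = 0` for a good slice (`∫ ∇k = 0`, `∫ Δk = 0`), obtained from the pairing
identity with the constant weight `1`. [folklore] -/
theorem integral_flux_eq_zero {θs : UnitAddTorus d → ℝ} {v : UnitAddTorus d → EuclideanSpace ℝ d}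
    (hδ : Integrable θs volume) (hv : AEStronglyMeasurable v volume)
    (hvδ : Integrable (fun y => ‖v y‖ * θs y) volume) {ε : ℝ} (hε : 0 < ε) (hε' : ε ≤ 1 / 4) (κ : ℝ) :
    ∫ x, ∫ y, θs y * (-⟪v y, FunctionSpaces.Torus.gradient (kernel ε) (x - y)⟫_ℝ + κ * FunctionSpaces.Torus.laplacian (kernel ε) (x - y)) = 0 := by
  have hL : LipschitzWith 0 (fun _ : UnitAddTorus d => (1 : ℝ)) := LipschitzWith.const (1 : ℝ)
  have h := integral_mul_flux_eq hδ hv hvδ hL hε hε' κ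
  simp only [one_mul] at h
  rw [h]
  have hg : ∀ x : UnitAddTorus d, FunctionSpaces.Torus.gradient (fun _ : UnitAddTorus d => (1 : ℝ)) x = 0 := fun x =>
    gradient_fun_const _ _
  have hconv : ((fun _ : UnitAddTorus d => (1 : ℝ)) ⋆ kernel ε) = fun _ => (1 : ℝ) := by
    funext y
    rw [convolution_lsmul]
    simp only [smul_eq_mul, one_mul]
    rw [integral_sub_left_eq_self (kernel (d := d) ε) volume y, integral_kernel hε hε']
  have hl : ∀ y : UnitAddTorus d, FunctionSpaces.Torus.laplacian (fun _ : UnitAddTorus d => (1 : ℝ)) y = 0 := fun y => by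
    have : liftAt (fun _ : UnitAddTorus d => (1 : ℝ)) y = fun _ => (1 : ℝ) := rfl
    rw [FunctionSpaces.Torus.laplacian, this, InnerProductSpace.laplacian_const]
    rfl
  simp [hg, hconv, hl]

omit [DecidableEq d] in
/-- **Sup-closeness of the representative in time**: for `0 ≤ t' ≤ t < T`,
`|Ã(t,x) - Ã(t',x)| ≤ ∫_{(t',t]} bound` for all `x`, with the flux majorant `bound`. [folklore] -/
theorem abs_molRep_sub_le (h : IsWeakScalarTransportOn T κ u θ₀ θ) {k : UnitAddTorus d → ℝ}
    (hk : IsSmooth k) {bound : ℝ → ℝ} (hbi : IntegrableOn bound (Ioo 0 T) volume)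
    (hGb : ∀ᵐ s ∂(volume.restrict (Ioo 0 T)), ∀ x,
      ‖∫ y, θ s y * (-⟪u s y, FunctionSpaces.Torus.gradient k (x - y)⟫_ℝ + κ * FunctionSpaces.Torus.laplacian k (x - y))‖ ≤ bound s)
    {t' t : ℝ} (ht' : 0 ≤ t') (htt : t' ≤ t) (ht : t < T) (x : UnitAddTorus d) :
    |molRep κ u θ₀ θ k t x - molRep κ u θ₀ θ k t' x| ≤ ∫ s in Ioc t' t, bound s := by
  have hsub : Ioc t' t ⊆ Ioo 0 T := fun s hs => ⟨ht'.trans_lt hs.1, hs.2.trans_lt ht⟩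
  have hsub0' : Ioc 0 t' ⊆ Ioo 0 T := Ioc_subset_Ioo_right (htt.trans_lt ht)
  have hGx : IntegrableOn (fun s => ∫ y, θ s y *
      (-⟪u s y, FunctionSpaces.Torus.gradient k (x - y)⟫_ℝ + κ * FunctionSpaces.Torus.laplacian k (x - y))) (Ioo 0 T) volume :=
    (h.integrable_mul_flux hk x).integral_prod_left
  have hpt : molRep κ u θ₀ θ k t x - molRep κ u θ₀ θ k t' x =
      ∫ s in Ioc t' t, ∫ y, θ s y * (-⟪u s y, FunctionSpaces.Torus.gradient k (x - y)⟫_ℝ + κ * FunctionSpaces.Torus.laplacian k (x - y)) := by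
    simp only [molRep]
    rw [add_sub_add_left_eq_sub, ← Ioc_union_Ioc_eq_Ioc ht' htt,
      setIntegral_union (Ioc_disjoint_Ioc_of_le le_rfl) measurableSet_Ioc (hGx.mono_set hsub0') (hGx.mono_set hsub)]
    ring
  rw [hpt, ← Real.norm_eq_abs]
  refine norm_integral_le_of_norm_le (hbi.mono_set hsub) (ae_restrict_of_ae_restrict_of_subset hsub ?_)
  filter_upwards [hGb] with s hs
  exact hs x

omit [DecidableEq d] in
/-- The representative `Ã(t, ·)` is continuous for `t < T`. [folklore] -/
theorem continuous_molRep (h : IsWeakScalarTransportOn T κ u θ₀ θ) (hθ₀ : Integrable θ₀ volume)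
    {k : UnitAddTorus d → ℝ} (hk : IsSmooth k) {t : ℝ} (ht : t < T) :
    Continuous (molRep κ u θ₀ θ k t) := by
  obtain ⟨bound, hbi, hGb⟩ := h.exists_flux_bound₁ hk
  have hsub : Ioc 0 t ⊆ Ioo 0 T := Ioc_subset_Ioo_right ht
  have hA0c : Continuous fun x => ∫ y, θ₀ y * k (x - y) := by
    have e : (fun x => ∫ y, θ₀ y * k (x - y)) = θ₀ ⋆ k := by
      funext x; simp only [convolution_lsmul, smul_eq_mul]
    rw [e]; exact continuous_convolution hθ₀ hk.continuous
  refine hA0c.add ?_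
  refine continuous_of_dominated (bound := bound) (fun x => ?_) (fun x => ?_) (hbi.mono_set hsub) ?_
  · have hGi : IntegrableOn (fun s => ∫ y, θ s y *
        (-⟪u s y, FunctionSpaces.Torus.gradient k (x - y)⟫_ℝ + κ * FunctionSpaces.Torus.laplacian k (x - y))) (Ioo 0 T) volume :=
      (h.integrable_mul_flux hk x).integral_prod_left
    exact (hGi.mono_set hsub).aestronglyMeasurable
  · exact ae_restrict_of_ae_restrict_of_subset hsub (hGb.mono fun s hs => hs x)
  · refine ae_restrict_of_ae_restrict_of_subset hsub ?_
    filter_upwards [h.ae_slice_integrable₁] with s hs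
    exact continuous_fluxIntegral (δ := θ s) hs.1 hs.2.1 hs.2.2 hk κ

omit [DecidableEq d] in
/-- At time `0` the representative is `θ₀ ⋆ k`. [folklore] -/
theorem molRep_zero (k : UnitAddTorus d → ℝ) : molRep κ u θ₀ θ k 0 = θ₀ ⋆ k := by
  funext x
  simp only [molRep, Ioc_self, Measure.restrict_empty, integral_zero_measure, add_zero, convolution_lsmul,
    smul_eq_mul]

omit [DecidableEq d] in
/-- The representative is mean-zero for mean-zero `θ₀` (`0 ≤ t < T`, the standard kernel). [folklore] -/
theorem integral_molRep_eq_zero (h : IsWeakScalarTransportOn T κ u θ₀ θ) (hθ₀ : Integrable θ₀ volume)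
    (h0 : ∫ x, θ₀ x = 0) {ε : ℝ} (hε : 0 < ε) (hε' : ε ≤ 1 / 4) {t : ℝ} (ht0 : 0 ≤ t) (ht : t < T) :
    ∫ x, molRep κ u θ₀ θ (kernel ε) t x = 0 := by
  have hk := isSmooth_kernel (d := d) hε hε'
  -- at time `0`
  have hzero : ∫ x, molRep κ u θ₀ θ (kernel ε) 0 x = 0 := by
    rw [molRep_zero, integral_convolution (ContinuousLinearMap.lsmul ℝ ℝ) hθ₀ hk.integrable, ContinuousLinearMap.lsmul_apply, h0, zero_smul]
  -- the increment has zero mean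
  have hincr := h.integral_mul_molRep_sub hθ₀ hk (aestronglyMeasurable_const (b := (1 : ℝ))) (Cw := 1)
    (fun x => by simp) le_rfl ht0 ht
  simp only [one_mul] at hincr
  rw [hzero, sub_zero] at hincr
  rw [hincr]
  refine integral_eq_zero_of_ae ?_
  refine ae_restrict_of_ae_restrict_of_subset (Ioc_subset_Ioo_right ht) ?_
  filter_upwards [h.ae_slice_integrable₁] with s hs
  exact integral_flux_eq_zero hs.1 hs.2.1 hs.2.2 hε hε' κ

/-! ## The distance along the representative is absolutely continuous -/

omit [DecidableEq d] in
/-- **`t ↦ krLogDist δ (Ã(t))` is absolutely continuous on `[0, b]`, `b < T`**: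
`|F(t) - F(t')| ≤ log(1 + 1/(2δ)) ∫_{(t',t]} bound`. [folklore] -/
theorem absolutelyContinuousOnInterval_krLogDist_molRep (h : IsWeakScalarTransportOn T κ u θ₀ θ)
    (hθ₀ : Integrable θ₀ volume) (h0 : ∫ x, θ₀ x = 0) {δ : ℝ} (hδ : 0 < δ) {ε : ℝ} (hε : 0 < ε) (hε' : ε ≤ 1 / 4)
    {b : ℝ} (hb0 : 0 ≤ b) (hbT : b < T) :
    AbsolutelyContinuousOnInterval (fun t => krLogDist δ (molRep κ u θ₀ θ (kernel ε) t)) 0 b := by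
  have hk := isSmooth_kernel (d := d) hε hε'
  obtain ⟨bound, hbi, hGb⟩ := h.exists_flux_bound₁ hk
  set Λ : ℝ := Real.log (1 + 1 / (2 * δ)) with hΛ
  have hΛ0 : 0 ≤ Λ := log_one_add_inv_two_mul_nonneg hδ
  have hbI : IntervalIntegrable (fun s => Λ * bound s) volume 0 b :=
    (intervalIntegrable_iff_integrableOn_Ioc_of_le hb0).2 ((hbi.mono_set (Ioc_subset_Ioo_right hbT)).const_mul Λ)
  refine Calculus.absolutelyContinuousOnInterval_of_dist_le_integral hb0 hbI fun s t h0s hst htb => ?_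
  have htT : t < T := htb.trans_lt hbT
  have hsT : s < T := hst.trans_lt htT
  rw [Real.dist_eq, integral_of_le hst, MeasureTheory.integral_const_mul]
  refine (abs_krLogDist_sub_le hδ ((h.continuous_molRep hθ₀ hk hsT).integrable_unitAddTorus)
    ((h.continuous_molRep hθ₀ hk htT).integrable_unitAddTorus) (h.integral_molRep_eq_zero hθ₀ h0 hε hε' h0s hsT)
    (h.integral_molRep_eq_zero hθ₀ h0 hε hε' (h0s.trans hst) htT)).trans ?_
  refine mul_le_mul_of_nonneg_left ?_ hΛ0
  calc ∫ x, |molRep κ u θ₀ θ (kernel ε) s x - molRep κ u θ₀ θ (kernel ε) t x|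
      ≤ ∫ _ : UnitAddTorus d, ∫ r in Ioc s t, bound r := by
        refine integral_mono_of_nonneg (Eventually.of_forall fun x => abs_nonneg _) (integrable_const _)
          (Eventually.of_forall fun x => ?_)
        dsimp only
        rw [abs_sub_comm]
        exact h.abs_molRep_sub_le hk hbi hGb h0s hst htT x
    _ = ∫ r in Ioc s t, bound r := by simp

/-! ## The level-`ε` evolution inequality -/

set_option maxHeartbeats 800000 in
/-- **Seis 2022, Lemma 3 at a fixed mollification level, integrated and one-sided.** For a weak
solution with `L² ∩ Ḣ¹` drift (`‖∇u(t)‖²_{L²} ≤ G`, `‖u(t)‖²_{L²} ≤ M` a.e.), mean-zero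
`θ₀ ∈ L²`, `κ > 0`, `δ > 0`, `0 < ε ≤ 1/4` and `0 ≤ t < T`:
`krLogDist δ (θ₀ ⋆ k_ε) ≤ krLogDist δ (Ã(t)) + (C_d √G + δ⁻¹√d ε √G) ∫₀ᵗ ‖θ(s)‖₂ ds + κδ⁻¹ ∫₀ᵗ ‖∇θ(s)‖₂ ds`.
[cite: Seis2022, Lemma 3 (proof, pp. 7–8)] -/
theorem krLogDist_molRep_level (hκ : 0 < κ) (h : IsWeakScalarTransportOn T κ u θ₀ θ)
    (hθ₀ : MemLp θ₀ 2 volume) (h0 : ∫ x, θ₀ x = 0) {G M : ℝ≥0}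
    (hG : ∀ᵐ t ∂(volume.restrict (Ioo 0 T)), eGradNormSq (u t) ≤ G)
    (hM : ∀ᵐ t ∂(volume.restrict (Ioo 0 T)), ∫⁻ x, ‖u t x‖ₑ ^ 2 ≤ M)
    {δ : ℝ} (hδ : 0 < δ) {ε : ℝ} (hε : 0 < ε) (hε' : ε ≤ 1 / 4) {t : ℝ} (ht0 : 0 ≤ t) (htT : t < T) :
    krLogDist δ (θ₀ ⋆ kernel ε) ≤
      krLogDist δ (molRep κ u θ₀ θ (kernel ε) t) +
        ((pairingConst d).toReal * Real.sqrt G + δ⁻¹ * (Real.sqrt (Fintype.card d) * ε) * Real.sqrt G) *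
            (∫ s in Ioc 0 t, (eLpNorm (θ s) 2 volume).toReal) +
        κ * δ⁻¹ * ∫ s in Ioc 0 t, (eScalarGradNormSq (θ s) ^ (1 / 2 : ℝ)).toReal := by
  have hθ₀i : Integrable θ₀ volume := hθ₀.integrable one_le_two
  have hk := isSmooth_kernel (d := d) hε hε'
  have hk1 : ∫⁻ y, ‖kernel (d := d) ε y‖ₑ = 1 := lintegral_enorm_kernel hε hε'
  set k : UnitAddTorus d → ℝ := kernel ε with hk_def
  set μT : Measure ℝ := (volume : Measure ℝ).restrict (Ioo 0 T) with hμT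
  haveI : IsFiniteMeasure μT := by rw [hμT]; infer_instance
  -- degenerate case `t = 0`
  rcases ht0.eq_or_lt with ht00 | ht0'
  · subst ht00
    simp only [Ioc_self, Measure.restrict_empty, integral_zero_measure, mul_zero, add_zero, molRep_zero]
    exact le_rfl
  -- an intermediate horizon `b ∈ (t, T)`
  set b : ℝ := (t + T) / 2 with hb
  have htb : t < b := by rw [hb]; linarith
  have hbT : b < T := by rw [hb]; linarith
  have hb0 : 0 ≤ b := ht0.trans htb.le
  obtain ⟨bound, hbi, hGb⟩ := h.exists_flux_bound₁ hk
  obtain ⟨C₁, hC₁⟩ := h.exists_eLpNorm_le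
  -- `bound ≥ 0` a.e.
  have hbnn : ∀ᵐ s ∂μT, 0 ≤ bound s := by
    filter_upwards [hGb] with s hs
    exact (norm_nonneg _).trans (hs 0)
  -- ### the scalar functions of time
  set nθ : ℝ → ℝ := fun s => (eLpNorm (θ s) 2 volume).toReal with hnθ
  set eθ : ℝ → ℝ := fun s => (eScalarGradNormSq (θ s) ^ (1 / 2 : ℝ)).toReal with heθ
  have hnθm : AEStronglyMeasurable nθ μT :=
    (aemeasurable_eLpNorm_two_of_uncurry h.aestronglyMeasurable_uncurry).ennreal_toReal.aestronglyMeasurable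
  have hnθb : ∀ᵐ s ∂μT, ‖nθ s‖ ≤ C₁ := by
    filter_upwards [hC₁] with s hs
    rw [Real.norm_eq_abs, abs_of_nonneg ENNReal.toReal_nonneg]
    exact ENNReal.toReal_le_coe_of_le_coe hs
  have hnθi : Integrable nθ μT := Integrable.mono' (integrable_const (C₁ : ℝ)) hnθm hnθb
  have hnθ0 : ∀ s, 0 ≤ nθ s := fun s => ENNReal.toReal_nonneg
  -- `eθ` is integrable: `√E ≤ 1 + E` and `∫ E < ∞` by the energy inequality
  have hEm : AEMeasurable (fun s => eScalarGradNormSq (θ s)) μT := h.aemeasurable_eScalarGradNormSq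
  have hEfin : ∫⁻ s, eScalarGradNormSq (θ s) ∂μT ≠ ⊤ := by
    have h1 := energy_ineq_of_eGradNormSq_le hκ h hθ₀ hG
    have hat : ∫⁻ x, ‖θ₀ x‖ₑ ^ 2 ≠ ⊤ := by
      rw [← PassiveScalarProofs.eLpNorm_two_pow_two]; exact ENNReal.pow_ne_top hθ₀.eLpNorm_ne_top
    have h2 : eScalarDissipation κ θ 0 T ≠ ⊤ :=
      ne_top_of_le_ne_top hat ((le_mul_of_one_le_left bot_le one_le_two).trans h1)
    rw [eScalarDissipation] at h2
    intro htop
    rw [hμT] at htop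
    rw [htop, ENNReal.mul_top (ENNReal.ofReal_pos.2 hκ).ne'] at h2
    exact h2 rfl
  have hEae : ∀ᵐ s ∂μT, eScalarGradNormSq (θ s) < ⊤ := ae_lt_top' hEm hEfin
  have heθm : AEStronglyMeasurable eθ μT := (hEm.pow_const _).ennreal_toReal.aestronglyMeasurable
  have heθi : Integrable eθ μT := by
    have hEi : Integrable (fun s => (eScalarGradNormSq (θ s)).toReal) μT := integrable_toReal_of_lintegral_ne_top hEm hEfin
    refine Integrable.mono' ((integrable_const (1 : ℝ)).add hEi) heθm (Eventually.of_forall fun s => ?_)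
    rw [Real.norm_eq_abs, abs_of_nonneg ENNReal.toReal_nonneg]
    show (eScalarGradNormSq (θ s) ^ (1 / 2 : ℝ)).toReal ≤ 1 + (eScalarGradNormSq (θ s)).toReal
    rcases eq_or_ne (eScalarGradNormSq (θ s)) ⊤ with htop | hne
    · rw [htop, ENNReal.top_rpow_of_pos (by norm_num), ENNReal.toReal_top]; positivity
    · rw [← ENNReal.toReal_rpow]
      have hx : 0 ≤ (eScalarGradNormSq (θ s)).toReal := ENNReal.toReal_nonneg
      have hsq : (eScalarGradNormSq (θ s)).toReal ^ (1 / 2 : ℝ) = Real.sqrt (eScalarGradNormSq (θ s)).toReal := by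
        rw [Real.sqrt_eq_rpow]
      rw [hsq, Real.sqrt_le_left (by positivity)]
      nlinarith
  have heθ0 : ∀ s, 0 ≤ eθ s := fun s => ENNReal.toReal_nonneg
  -- ### the constants
  set Cp : ℝ := (pairingConst d).toReal * Real.sqrt G with hCp
  set Cc : ℝ := δ⁻¹ * (Real.sqrt (Fintype.card d) * ε) * Real.sqrt G with hCc
  have hCp0 : 0 ≤ Cp := by positivity
  have hCc0 : 0 ≤ Cc := by rw [hCc]; positivity
  -- ### the compensated function `H = F + K`
  set F : ℝ → ℝ := fun r => krLogDist δ (molRep κ u θ₀ θ k r) with hF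
  set kf : ℝ → ℝ := fun s => (Cp + Cc) * nθ s + κ * δ⁻¹ * eθ s with hkf
  have hkfi : Integrable kf μT := (hnθi.const_mul _).add (heθi.const_mul _)
  set K : ℝ → ℝ := fun r => ∫ s in (0 : ℝ)..r, kf s with hK
  set H : ℝ → ℝ := fun r => F r + K r with hH
  have hkft : IntervalIntegrable kf volume 0 t :=
    (intervalIntegrable_iff_integrableOn_Ioc_of_le ht0).2 (hkfi.mono_measure (Measure.restrict_mono_set _ (Ioc_subset_Ioo_right htT)))
  have hHac : AbsolutelyContinuousOnInterval H 0 t :=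
    (h.absolutelyContinuousOnInterval_krLogDist_molRep hθ₀i h0 hδ hε hε' ht0 htT).add
      (hkft.absolutelyContinuousOnInterval_intervalIntegral (c := 0) (by simp [ht0]))
  -- ### the good base points: representative = mollified slice, `L²` slice, Lebesgue point of `‖θ‖₂`
  have hnθI : IntervalIntegrable nθ volume 0 b :=
    (intervalIntegrable_iff_integrableOn_Ioc_of_le hb0).2 (hnθi.mono_measure (Measure.restrict_mono_set _ (Ioc_subset_Ioo_right hbT)))
  have hgood : ∀ᵐ t₀ ∂μT, (∀ x, molRep κ u θ₀ θ k t₀ x = (θ t₀ ⋆ k) x) ∧ MemLp (θ t₀) 2 volume ∧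
      (t₀ ∈ uIcc 0 b → HasDerivAt (fun y => ∫ s in (0 : ℝ)..y, nθ s) (nθ t₀) t₀) := by
    have hD : ∀ᵐ t₀ ∂μT, t₀ ∈ uIcc 0 b → HasDerivAt (fun y => ∫ s in (0 : ℝ)..y, nθ s) (nθ t₀) t₀ := by
      rw [hμT]
      refine ae_restrict_of_ae ?_
      filter_upwards [hnθI.ae_hasDerivAt_integral] with t₀ ht₀ hmem
      exact ht₀ hmem 0 (by simp [hb0])
    filter_upwards [h.ae_molRep_eq hθ₀i hk, h.ae_memLp_two, hD] with t₀ h1 h2 h3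
    exact ⟨h1, h2, h3⟩
  -- ### the good slices
  have hslice : ∀ᵐ s ∂μT, (Integrable (θ s) volume ∧ AEStronglyMeasurable (u s) volume ∧
      Integrable (fun y => ‖u s y‖ * θ s y) volume) ∧ MemLp (θ s) 2 volume ∧ eScalarGradNormSq (θ s) < ⊤ ∧
      MemLp (u s) 2 volume ∧ eGradNormSq (u s) ≤ G ∧ (∫⁻ x, ‖u s x‖ₑ ^ 2 ≤ M) ∧
      (∀ x, molRep κ u θ₀ θ k s x = (θ s ⋆ k) x) ∧ 0 ≤ bound s := by
    filter_upwards [h.ae_slice_integrable₁, h.ae_memLp_two, hEae, h.ae_memLp_two_velocity, hG, hM,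
      h.ae_molRep_eq hθ₀i hk, hbnn] with s h1 h2 h3 h4 h5 h6 h7 h8
    exact ⟨h1, h2, h3, h4, h5, h6, h7, h8⟩
  have hslice' : ∀ᵐ s : ℝ, s ∈ Ioo 0 T → (Integrable (θ s) volume ∧ AEStronglyMeasurable (u s) volume ∧
      Integrable (fun y => ‖u s y‖ * θ s y) volume) ∧ MemLp (θ s) 2 volume ∧ eScalarGradNormSq (θ s) < ⊤ ∧
      MemLp (u s) 2 volume ∧ eGradNormSq (u s) ≤ G ∧ (∫⁻ x, ‖u s x‖ₑ ^ 2 ≤ M) ∧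
      (∀ x, molRep κ u θ₀ θ k s x = (θ s ⋆ k) x) ∧ 0 ≤ bound s := by
    rw [hμT, ae_restrict_iff' measurableSet_Ioo] at hslice
    exact hslice
  -- ### the Dini estimate at good base points
  have hDini : ∀ᵐ t₀ : ℝ, t₀ ∈ Ioo 0 t → ∀ c : ℝ, 0 < c → ∃ᶠ hh in 𝓝[>] (0 : ℝ), -c * hh ≤ H (t₀ + hh) - H t₀ := by
    have hgood' : ∀ᵐ t₀ : ℝ, t₀ ∈ Ioo 0 T → (∀ x, molRep κ u θ₀ θ k t₀ x = (θ t₀ ⋆ k) x) ∧ MemLp (θ t₀) 2 volume ∧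
        (t₀ ∈ uIcc 0 b → HasDerivAt (fun y => ∫ s in (0 : ℝ)..y, nθ s) (nθ t₀) t₀) := by
      rw [hμT, ae_restrict_iff' measurableSet_Ioo] at hgood
      exact hgood
    filter_upwards [hgood'] with t₀ ht₀ ht₀t c hc
    have ht₀T : t₀ ∈ Ioo 0 T := ⟨ht₀t.1, ht₀t.2.trans htT⟩
    obtain ⟨hrep, hθ2, hder⟩ := ht₀ ht₀T
    have hder' := hder (by rw [uIcc_of_le hb0]; exact ⟨ht₀t.1.le, (ht₀t.2.trans htb).le⟩)
    -- the frozen profile and its optimal pair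
    set A₀ : UnitAddTorus d → ℝ := molRep κ u θ₀ θ k t₀ with hA₀
    have hA₀eq : A₀ = θ t₀ ⋆ k := funext hrep
    have hθt₀i : Integrable (θ t₀) volume := hθ2.integrable one_le_two
    have hA₀c : Continuous A₀ := by rw [hA₀eq]; exact continuous_convolution hθt₀i hk.continuous
    have hA₀i : Integrable A₀ volume := hA₀c.integrable_unitAddTorus
    have hA₀0 : ∫ x, A₀ x = 0 := h.integral_molRep_eq_zero hθ₀i h0 hε hε' ht₀t.1.le ht₀T.2
    obtain ⟨π, ζ, hπ, hζ, hval, -, hae⟩ := exists_isCoupling_gradient hδ hA₀i hA₀0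
    have hae' : ∀ᵐ z ∂π, FunctionSpaces.Torus.gradient ζ z.1 = FunctionSpaces.Torus.gradient ζ z.2 ∧ ‖FunctionSpaces.Torus.gradient ζ z.1‖ ≤ (δ + dist z.1 z.2)⁻¹ :=
      hae.mono fun z hz => ⟨hz.2.1, hz.2.2⟩
    -- `ζ` is bounded and continuous
    set Cζ : ℝ := |ζ 0| + Real.log (1 + 1 / (2 * δ)) with hCζ
    have hζb : ∀ x, |ζ x| ≤ Cζ := fun x => hζ.abs_le hδ x
    have hζm : AEStronglyMeasurable ζ volume := (hζ.continuous hδ).aestronglyMeasurable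
    -- Young: `‖A₀‖₂ ≤ ‖θ t₀‖₂`
    have hnA₀ : (eLpNorm A₀ 2 volume).toReal ≤ nθ t₀ := by
      refine ENNReal.toReal_mono hθ2.eLpNorm_ne_top ?_
      rw [hA₀eq]
      calc eLpNorm (θ t₀ ⋆ k) 2 volume ≤ (∫⁻ y, ‖k y‖ₑ) * eLpNorm (θ t₀) 2 volume :=
            eLpNorm_convolution_le hθ2.1 hk.continuous.aestronglyMeasurable one_le_two
        _ = eLpNorm (θ t₀) 2 volume := by rw [hk1, one_mul]
    -- the tail of the majorant
    set W : ℝ → ℝ := fun hh => ∫ r in Ioc t₀ (t₀ + hh), bound r with hW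
    have hW0 : Tendsto W (𝓝[>] (0 : ℝ)) (𝓝 0) := by
      have h1 : Tendsto (fun hh : ℝ => (volume : Measure ℝ) (Ioc t₀ (t₀ + hh))) (𝓝[>] (0 : ℝ)) (𝓝 0) := by
        have e : (fun hh : ℝ => (volume : Measure ℝ) (Ioc t₀ (t₀ + hh))) = fun hh => ENNReal.ofReal hh := by
          funext hh; rw [Real.volume_Ioc, add_sub_cancel_left]
        rw [e, ← ENNReal.ofReal_zero]
        exact (ENNReal.continuous_ofReal.tendsto 0).mono_left nhdsWithin_le_nhds
      -- the set integral over the shrinking strips tends to `0`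
      have hμs : Tendsto (fun hh : ℝ => μT (Ioc t₀ (t₀ + hh))) (𝓝[>] (0 : ℝ)) (𝓝 0) := by
        refine tendsto_of_tendsto_of_tendsto_of_le_of_le tendsto_const_nhds h1 (fun _ => bot_le) fun hh => ?_
        rw [hμT]
        exact Measure.restrict_apply_le _ _
      have h2 := hbi.tendsto_setIntegral_nhds_zero (s := fun hh : ℝ => Ioc t₀ (t₀ + hh)) hμs
      -- for small `hh` the double restriction is the plain strip
      have hev : ∀ᶠ hh in 𝓝[>] (0 : ℝ), hh < T - t₀ :=
        (eventually_lt_nhds (sub_pos.2 ht₀T.2)).filter_mono nhdsWithin_le_nhds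
      refine h2.congr' ?_
      filter_upwards [hev, self_mem_nhdsWithin] with hh hhT hh0
      have hsub' : Ioc t₀ (t₀ + hh) ⊆ Ioo 0 T := fun s hs => ⟨ht₀t.1.trans hs.1, hs.2.trans_lt (by linarith)⟩
      rw [Measure.restrict_restrict measurableSet_Ioc, inter_eq_left.2 hsub']
    -- monotonicity of the strip integrals of the (a.e. nonnegative) majorant
    have hWmono : ∀ {hh s : ℝ}, t₀ < s → s ≤ t₀ + hh → t₀ + hh < T →
        ∫ r in Ioc t₀ s, bound r ≤ W hh := by
      intro hh s hs1 hs2 hhT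
      have hsub : Ioc t₀ (t₀ + hh) ⊆ Ioo 0 T := fun r hr => ⟨ht₀t.1.trans hr.1, hr.2.trans_lt hhT⟩
      refine setIntegral_mono_set (hbi.mono_set hsub) ?_ (Ioc_subset_Ioc le_rfl hs2).eventuallyLE
      exact ae_restrict_of_ae_restrict_of_subset hsub hbnn
    have hW0' : ∀ {hh : ℝ}, t₀ + hh < T → 0 ≤ W hh := by
      intro hh hhT
      have hsub : Ioc t₀ (t₀ + hh) ⊆ Ioo 0 T := fun r hr => ⟨ht₀t.1.trans hr.1, hr.2.trans_lt hhT⟩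
      exact setIntegral_nonneg_of_ae_restrict (ae_restrict_of_ae_restrict_of_subset hsub hbnn)
    -- ### the key one-step inequality
    have key : ∀ hh : ℝ, 0 < hh → t₀ + hh < T →
        Cp * ((∫ s in Ioc t₀ (t₀ + hh), nθ s) - hh * nθ t₀) - hh * (δ⁻¹ * Real.sqrt M * W hh) ≤
          H (t₀ + hh) - H t₀ := by
      intro hh hh0 hhT
      set t₁ : ℝ := t₀ + hh with ht₁
      have ht₀1 : t₀ ≤ t₁ := by rw [ht₁]; linarith
      have ht₁0 : 0 ≤ t₁ := ht₀t.1.le.trans ht₀1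
      have hsub1 : Ioc t₀ t₁ ⊆ Ioo 0 T := fun r hr => ⟨ht₀t.1.trans hr.1, hr.2.trans_lt hhT⟩
      have hle1 : (volume : Measure ℝ).restrict (Ioc t₀ t₁) ≤ μT := by rw [hμT]; exact Measure.restrict_mono_set _ hsub1
      haveI : IsFiniteMeasure ((volume : Measure ℝ).restrict (Ioc t₀ t₁)) := by infer_instance
      have hvol : ((volume : Measure ℝ) (Ioc t₀ t₁)).toReal = hh := by
        rw [Real.volume_Ioc, ht₁, add_sub_cancel_left, ENNReal.toReal_ofReal hh0.le]
      -- (i)–(ii): the envelope step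
      have hrep1i : Integrable (molRep κ u θ₀ θ k t₁) volume := (h.continuous_molRep hθ₀i hk hhT).integrable_unitAddTorus
      have hrep10 : ∫ x, molRep κ u θ₀ θ k t₁ x = 0 := h.integral_molRep_eq_zero hθ₀i h0 hε hε' ht₁0 hhT
      have hF1 : ∫ x, molRep κ u θ₀ θ k t₁ x * ζ x ≤ F t₁ := integral_mul_le_krLogDist hδ hrep1i hrep10 hζ
      have hF0 : F t₀ = ∫ x, A₀ x * ζ x := hval.symm
      set g : ℝ → ℝ := fun s => ∫ x, ζ x * ∫ y, θ s y *
        (-⟪u s y, FunctionSpaces.Torus.gradient k (x - y)⟫_ℝ + κ * FunctionSpaces.Torus.laplacian k (x - y)) with hg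
      have hincr : (∫ x, ζ x * molRep κ u θ₀ θ k t₁ x) - ∫ x, ζ x * molRep κ u θ₀ θ k t₀ x = ∫ s in Ioc t₀ t₁, g s :=
        h.integral_mul_molRep_sub hθ₀i hk hζm hζb ht₀t.1.le ht₀1 hhT
      have hstep : ∫ s in Ioc t₀ t₁, g s ≤ F t₁ - F t₀ := by
        have e1 : ∫ x, ζ x * molRep κ u θ₀ θ k t₁ x = ∫ x, molRep κ u θ₀ θ k t₁ x * ζ x :=
          integral_congr_ae (Eventually.of_forall fun x => mul_comm _ _)
        have e2 : ∫ x, ζ x * molRep κ u θ₀ θ k t₀ x = ∫ x, A₀ x * ζ x :=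
          integral_congr_ae (Eventually.of_forall fun x => mul_comm _ _)
        have e3 : ∫ s in Ioc t₀ t₁, g s = (∫ x, ζ x * molRep κ u θ₀ θ k t₁ x) - ∫ x, ζ x * molRep κ u θ₀ θ k t₀ x := hincr.symm
        rw [e3, e1, e2, ← hF0]
        linarith
      -- (iii): the slice lower bound, a.e. on the strip
      set nA : ℝ := (eLpNorm A₀ 2 volume).toReal with hnA
      set ℓ : ℝ → ℝ := fun s => (pairingConst d).toReal * nA * Real.sqrt G + δ⁻¹ * Real.sqrt M * W hh +
        δ⁻¹ * (Real.sqrt (Fintype.card d) * ε) * nθ s * Real.sqrt G + κ * δ⁻¹ * eθ s with hℓ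
      have hgi : IntegrableOn g (Ioc t₀ t₁) volume :=
        ((h.integrable_weight_mul_flux hk hζm hζb).integral_prod_left).mono_measure hle1
      have hℓi : IntegrableOn ℓ (Ioc t₀ t₁) volume := by
        refine Integrable.add (Integrable.add (integrable_const _) ?_) ?_
        · have := ((hnθi.mono_measure hle1).const_mul (δ⁻¹ * (Real.sqrt (Fintype.card d) * ε))).mul_const (Real.sqrt G)
          exact this
        · exact (heθi.mono_measure hle1).const_mul _
      have hae_strip : ∀ᵐ s ∂((volume : Measure ℝ).restrict (Ioc t₀ t₁)), -ℓ s ≤ g s := by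
        have hmem : ∀ᵐ s ∂((volume : Measure ℝ).restrict (Ioc t₀ t₁)), s ∈ Ioc t₀ t₁ := ae_restrict_mem measurableSet_Ioc
        have hsl := ae_restrict_of_ae_restrict_of_subset hsub1 hslice
        filter_upwards [hmem, hsl] with s hs hss
        obtain ⟨⟨hθi, hum, huθ⟩, hθ2s, hEs, hu2, huG, huM, hreps, -⟩ := hss
        have hsT : s < T := hs.2.trans_lt hhT
        have hws : ∀ x, |(θ s ⋆ kernel ε) x - A₀ x| ≤ W hh := fun x => by
          rw [← hk_def, ← hreps x]
          exact (h.abs_molRep_sub_le hk hbi hGb ht₀t.1.le hs.1.le hsT x).trans (hWmono hs.1 hs.2 hhT)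
        have hmain := integral_mul_flux_ge (κ := κ) hδ hε hε' hκ.le hθ2s hEs.ne hu2 huG huM hA₀c hπ hζ hae' hws
        rw [hℓ]
        dsimp only
        exact hmain
      have hiii : -(∫ s in Ioc t₀ t₁, ℓ s) ≤ ∫ s in Ioc t₀ t₁, g s := by
        rw [← MeasureTheory.integral_neg]
        exact integral_mono_ae hℓi.neg hgi hae_strip
      -- (iv): evaluate `∫ ℓ` and the increment of `K`
      set In : ℝ := ∫ s in Ioc t₀ t₁, nθ s with hIn
      set Ie : ℝ := ∫ s in Ioc t₀ t₁, eθ s with hIe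
      have hℓval : ∫ s in Ioc t₀ t₁, ℓ s = hh * ((pairingConst d).toReal * nA * Real.sqrt G + δ⁻¹ * Real.sqrt M * W hh) +
          δ⁻¹ * (Real.sqrt (Fintype.card d) * ε) * Real.sqrt G * In + κ * δ⁻¹ * Ie := by
        set c0 : ℝ := (pairingConst d).toReal * nA * Real.sqrt G + δ⁻¹ * Real.sqrt M * W hh with hc0
        set b1 : ℝ := δ⁻¹ * (Real.sqrt (Fintype.card d) * ε) * Real.sqrt G with hb1
        have i2 : Integrable (fun s => b1 * nθ s) ((volume : Measure ℝ).restrict (Ioc t₀ t₁)) := (hnθi.mono_measure hle1).const_mul _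
        have i3 : Integrable (fun s => κ * δ⁻¹ * eθ s) ((volume : Measure ℝ).restrict (Ioc t₀ t₁)) := (heθi.mono_measure hle1).const_mul _
        have e0 : ∫ s in Ioc t₀ t₁, ℓ s = ∫ s in Ioc t₀ t₁, (c0 + (b1 * nθ s + κ * δ⁻¹ * eθ s)) := by
          refine integral_congr_ae (Eventually.of_forall fun s => ?_)
          rw [hℓ]; dsimp only; rw [hc0, hb1]; ring
        have e1 : ∫ s in Ioc t₀ t₁, (c0 + (b1 * nθ s + κ * δ⁻¹ * eθ s)) =
            (∫ _ in Ioc t₀ t₁, c0) + ∫ s in Ioc t₀ t₁, (b1 * nθ s + κ * δ⁻¹ * eθ s) :=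
          integral_add (integrable_const c0) (i2.add i3)
        have e2 : ∫ s in Ioc t₀ t₁, (b1 * nθ s + κ * δ⁻¹ * eθ s) = (∫ s in Ioc t₀ t₁, b1 * nθ s) + ∫ s in Ioc t₀ t₁, κ * δ⁻¹ * eθ s :=
          integral_add i2 i3
        have e3 : ∫ _ in Ioc t₀ t₁, c0 = hh * c0 := by
          rw [setIntegral_const, measureReal_def, hvol, smul_eq_mul]
        have e4 : ∫ s in Ioc t₀ t₁, b1 * nθ s = b1 * In := by rw [hIn]; exact MeasureTheory.integral_const_mul _ _
        have e5 : ∫ s in Ioc t₀ t₁, κ * δ⁻¹ * eθ s = κ * δ⁻¹ * Ie := by rw [hIe]; exact MeasureTheory.integral_const_mul _ _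
        rw [e0, e1, e2, e3, e4, e5]
        ring
      have hKval : K t₁ - K t₀ = (Cp + Cc) * In + κ * δ⁻¹ * Ie := by
        have hI1 : IntervalIntegrable kf volume 0 t₁ :=
          (intervalIntegrable_iff_integrableOn_Ioc_of_le ht₁0).2 (hkfi.mono_measure (Measure.restrict_mono_set _ (Ioc_subset_Ioo_right hhT)))
        have hI0 : IntervalIntegrable kf volume 0 t₀ :=
          (intervalIntegrable_iff_integrableOn_Ioc_of_le ht₀t.1.le).2 (hkfi.mono_measure (Measure.restrict_mono_set _ (Ioc_subset_Ioo_right ht₀T.2)))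
        have e0 : K t₁ - K t₀ = ∫ s in Ioc t₀ t₁, kf s := by
          rw [hK]; dsimp only
          rw [integral_interval_sub_left hI1 hI0, integral_of_le ht₀1]
        have i2 : Integrable (fun s => (Cp + Cc) * nθ s) ((volume : Measure ℝ).restrict (Ioc t₀ t₁)) := (hnθi.mono_measure hle1).const_mul _
        have i3 : Integrable (fun s => κ * δ⁻¹ * eθ s) ((volume : Measure ℝ).restrict (Ioc t₀ t₁)) := (heθi.mono_measure hle1).const_mul _
        have e1 : ∫ s in Ioc t₀ t₁, kf s = (∫ s in Ioc t₀ t₁, (Cp + Cc) * nθ s) + ∫ s in Ioc t₀ t₁, κ * δ⁻¹ * eθ s := by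
          rw [hkf]; exact integral_add i2 i3
        have e4 : ∫ s in Ioc t₀ t₁, (Cp + Cc) * nθ s = (Cp + Cc) * In := by rw [hIn]; exact MeasureTheory.integral_const_mul _ _
        have e5 : ∫ s in Ioc t₀ t₁, κ * δ⁻¹ * eθ s = κ * δ⁻¹ * Ie := by rw [hIe]; exact MeasureTheory.integral_const_mul _ _
        rw [e0, e1, e4, e5]
      -- (v): combine
      have hH : H t₁ - H t₀ = (F t₁ - F t₀) + (K t₁ - K t₀) := by rw [hH]; ring
      have hnA' : nA ≤ nθ t₀ := hnA₀
      have hpc0 : 0 ≤ (pairingConst d).toReal * Real.sqrt G := by positivity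
      rw [hH, hKval]
      have hcomb : Cp * (In - hh * nθ t₀) - hh * (δ⁻¹ * Real.sqrt M * W hh) ≤
          -(∫ s in Ioc t₀ t₁, ℓ s) + ((Cp + Cc) * In + κ * δ⁻¹ * Ie) := by
        rw [hℓval, hCp, hCc]
        have : (pairingConst d).toReal * Real.sqrt G * (hh * nA) ≤ (pairingConst d).toReal * Real.sqrt G * (hh * nθ t₀) :=
          mul_le_mul_of_nonneg_left (mul_le_mul_of_nonneg_left hnA' hh0.le) hpc0
        nlinarith [this]
      linarith [hcomb, hiii, hstep]
    -- ### the Dini conclusion: eventually `-c hh ≤ H(t₀ + hh) - H t₀`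
    have hslope : Tendsto (fun hh : ℝ => hh⁻¹ * ∫ s in Ioc t₀ (t₀ + hh), nθ s) (𝓝[>] (0 : ℝ)) (𝓝 (nθ t₀)) := by
      have h1 := hder'.tendsto_slope_zero_right
      have hev : ∀ᶠ hh in 𝓝[>] (0 : ℝ), hh < b - t₀ :=
        (eventually_lt_nhds (sub_pos.2 (ht₀t.2.trans htb))).filter_mono nhdsWithin_le_nhds
      refine h1.congr' ?_
      filter_upwards [hev, self_mem_nhdsWithin] with hh hhb hh0
      have hh0' : (0 : ℝ) < hh := hh0
      have hI1 : IntervalIntegrable nθ volume 0 (t₀ + hh) :=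
        hnθI.mono_set (by rw [uIcc_of_le hb0, uIcc_of_le (by linarith [ht₀t.1])]; exact Icc_subset_Icc le_rfl (by linarith [ht₀t.2]))
      have hI0 : IntervalIntegrable nθ volume 0 t₀ :=
        hnθI.mono_set (by rw [uIcc_of_le hb0, uIcc_of_le ht₀t.1.le]; exact Icc_subset_Icc le_rfl (by linarith [ht₀t.2]))
      rw [smul_eq_mul, integral_interval_sub_left hI1 hI0, integral_of_le (by linarith)]
    have hc' : 0 < c / (2 * (Cp + 1)) := by positivity
    have hev1 : ∀ᶠ hh in 𝓝[>] (0 : ℝ), |hh⁻¹ * (∫ s in Ioc t₀ (t₀ + hh), nθ s) - nθ t₀| < c / (2 * (Cp + 1)) := by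
      have := (Metric.tendsto_nhds.1 hslope) _ hc'
      exact this.mono fun hh hhh => by rwa [Real.dist_eq] at hhh
    have hev2 : ∀ᶠ hh in 𝓝[>] (0 : ℝ), |W hh| < δ * (c / 2) / (Real.sqrt M + 1) := by
      have hpos : 0 < δ * (c / 2) / (Real.sqrt M + 1) := by positivity
      have := (Metric.tendsto_nhds.1 hW0) _ hpos
      exact this.mono fun hh hhh => by rwa [Real.dist_eq, sub_zero] at hhh
    have hev3 : ∀ᶠ hh in 𝓝[>] (0 : ℝ), hh < T - t₀ :=
      (eventually_lt_nhds (sub_pos.2 ht₀T.2)).filter_mono nhdsWithin_le_nhds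
    refine Filter.Eventually.frequently ?_
    filter_upwards [hev1, hev2, hev3, self_mem_nhdsWithin] with hh h1 h2 h3 hh0
    have hh0' : (0 : ℝ) < hh := hh0
    have hkey := key hh hh0' (by linarith)
    -- `|∫ nθ - hh nθ t₀| ≤ (c / (2(Cp+1))) hh`
    have hA : -(c / (2 * (Cp + 1)) * hh) ≤ (∫ s in Ioc t₀ (t₀ + hh), nθ s) - hh * nθ t₀ := by
      have e : hh⁻¹ * (∫ s in Ioc t₀ (t₀ + hh), nθ s) - nθ t₀ = ((∫ s in Ioc t₀ (t₀ + hh), nθ s) - hh * nθ t₀) / hh := by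
        field_simp
      rw [e, abs_div, abs_of_pos hh0', div_lt_iff₀ hh0'] at h1
      linarith [neg_abs_le ((∫ s in Ioc t₀ (t₀ + hh), nθ s) - hh * nθ t₀)]
    -- `δ⁻¹ √M W hh ≤ c/2`
    have hB : δ⁻¹ * Real.sqrt M * W hh ≤ c / 2 := by
      have hWle : W hh ≤ δ * (c / 2) / (Real.sqrt M + 1) := (le_abs_self _).trans h2.le
      have hM0 : 0 ≤ Real.sqrt M := Real.sqrt_nonneg _
      calc δ⁻¹ * Real.sqrt M * W hh ≤ δ⁻¹ * Real.sqrt M * (δ * (c / 2) / (Real.sqrt M + 1)) :=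
            mul_le_mul_of_nonneg_left hWle (by positivity)
        _ = (Real.sqrt M / (Real.sqrt M + 1)) * (c / 2) := by field_simp
        _ ≤ 1 * (c / 2) := by
            refine mul_le_mul_of_nonneg_right ?_ (by positivity)
            rw [div_le_one (by positivity)]; linarith
        _ = c / 2 := one_mul _
    have hCpA : -(c / 2 * hh) ≤ Cp * ((∫ s in Ioc t₀ (t₀ + hh), nθ s) - hh * nθ t₀) := by
      have h' := mul_le_mul_of_nonneg_left hA hCp0
      have : Cp * (c / (2 * (Cp + 1)) * hh) ≤ c / 2 * hh := by
        rw [show Cp * (c / (2 * (Cp + 1)) * hh) = (Cp / (Cp + 1)) * (c / 2 * hh) by field_simp]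
        refine mul_le_of_le_one_left (by positivity) ?_
        rw [div_le_one (by positivity)]; linarith
      nlinarith [h', this]
    nlinarith [hkey, hCpA, hB, mul_le_mul_of_nonneg_left hB hh0'.le]
  -- ### conclude with the monotonicity of `H`
  have hmono := Calculus.le_of_absolutelyContinuousOnInterval_of_frequently ht0 hHac hDini
  have hmono' : F 0 + K 0 ≤ F t + K t := hmono
  have hK0 : K 0 = 0 := intervalIntegral.integral_same
  have hF0' : F 0 = krLogDist δ (θ₀ ⋆ kernel ε) := by
    show krLogDist δ (molRep κ u θ₀ θ k 0) = krLogDist δ (θ₀ ⋆ kernel ε)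
    rw [molRep_zero]
  have hKt : K t = (Cp + Cc) * (∫ s in Ioc 0 t, nθ s) + κ * δ⁻¹ * ∫ s in Ioc 0 t, eθ s := by
    have hle0 : (volume : Measure ℝ).restrict (Ioc 0 t) ≤ μT := by rw [hμT]; exact Measure.restrict_mono_set _ (Ioc_subset_Ioo_right htT)
    have i2 : Integrable (fun s => (Cp + Cc) * nθ s) ((volume : Measure ℝ).restrict (Ioc 0 t)) := (hnθi.mono_measure hle0).const_mul _
    have i3 : Integrable (fun s => κ * δ⁻¹ * eθ s) ((volume : Measure ℝ).restrict (Ioc 0 t)) := (heθi.mono_measure hle0).const_mul _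
    have e0 : K t = ∫ s in Ioc 0 t, kf s := by
      show (∫ s in (0 : ℝ)..t, kf s) = ∫ s in Ioc 0 t, kf s
      rw [integral_of_le ht0]
    have e1 : ∫ s in Ioc 0 t, kf s = (∫ s in Ioc 0 t, (Cp + Cc) * nθ s) + ∫ s in Ioc 0 t, κ * δ⁻¹ * eθ s := by
      show (∫ s in Ioc 0 t, ((Cp + Cc) * nθ s + κ * δ⁻¹ * eθ s)) = _
      exact integral_add i2 i3
    have e4 : ∫ s in Ioc 0 t, (Cp + Cc) * nθ s = (Cp + Cc) * ∫ s in Ioc 0 t, nθ s := MeasureTheory.integral_const_mul _ _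
    have e5 : ∫ s in Ioc 0 t, κ * δ⁻¹ * eθ s = κ * δ⁻¹ * ∫ s in Ioc 0 t, eθ s := MeasureTheory.integral_const_mul _ _
    rw [e0, e1, e4, e5]
  have hFt : F t = krLogDist δ (molRep κ u θ₀ θ (kernel ε) t) := rfl
  rw [hK0, add_zero, hF0', hKt, hFt, hCp, hCc] at hmono'
  linarith [hmono']

end IsWeakScalarTransportOn

end Torus

end Literature.Analysis.FluidPDE
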